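import Literature.AlgebraicGeometry.Resolution.WeightedCentreKillSegment
import HarnessLib

/-!
# THEOREM KL-F, the trichotomy (instrument, NOT a resolution theorem)

Engine 1 of the RESOLUTION OBSERVATORY toy model `W(f)` (RE-DERIVATION-eng1-g41 §3.3, THEOREM KL-F; CARVER-NOTES-eng1-g41 T84):
`Z` = the BOTTOM class of slots (the killed slots `¬ H z`, all of ONE weight, strictly lighter than every kept slot), `Φ` a graded
isotropy of `G` with `Φ ≡ id mod σ` on the bottom slots.  Then exactly as the engine's (α) / (β) / (γ):

* (α) `Φ` has a pure `σ^s`-term on some bottom slot; or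
* (β) `Φ` FIXES every bottom slot and `Φ ≡ id` modulo the ideal of the bottom slots (every `Φ(ε_x) − ε_x` dies under the kill;
  equivalently `Φ̄ = kill`); or
* (γ) the reduction `Φ̄ = killHom H ∘ Φ` is NOT the identity of `k[ε_H][σ]`, is a graded isotropy of the killed equation `killLight H G`,
  kills the bottom slots, and has the same pure coefficients as `Φ` (so e.g. "no pure `σ^p`-term on `W`" is inherited).

The one ingredient beyond `WeightedCentreKillSegment` is `map_CX_eq_of_bottom`: with `deg σ = ρ > 0`, a bottom slot WITHOUT pure terms
and with `(Φ ε_z)_0 = ε_z` is fixed — `(Φ ε_z)_s` (`s ≥ 1`) has weight `w z − sρ < w z = ` the least weight of any variable.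
References: the weighted frame [AbramovichTemkinWlodarczyk2024, Thm. 5.3.1 (2)–(3) (p. 1578), §5.1 (p. 1575)].  All statements are
OURS (toy-model bookkeeping); "pure logic over T82".
-/

namespace Literature.AlgebraicGeometry.Resolution.WeightedBlowup

open Polynomial

namespace KillSegment

variable {k : Type*} [CommRing k] {ι : Type*} (H : ι → Prop) [DecidablePred H] {w : ι → ℚ} {ρ : ℚ}

/-- **Bottom slots without pure terms are fixed** (ours): `ρ > 0`, the killed slots form the bottom class (one weight, below every
kept weight), `Φ` graded with no pure term on the bottom slot `z` and `(Φ ε_z)_0 = ε_z`; then `Φ (C ε_z) = C ε_z`.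
[cite: AbramovichTemkinWlodarczyk2024, Thm. 5.3.1 (2)–(3) (p. 1578)] -/
theorem map_CX_eq_of_bottom (hw : ∀ j, 0 ≤ w j) (hρ : 0 < ρ) (hsep : ∀ z x, ¬ H z → H x → w z < w x)
    (hclass : ∀ z z', ¬ H z → ¬ H z' → w z = w z') {Φ : (MvPolynomial ι k)[X] →+* (MvPolynomial ι k)[X]}
    (hΦ : IsGradedHom w ρ Φ) {z : ι} (hz : ¬ H z) (hpure : ∀ s, pureCoeff Φ z s = 0)
    (h0 : (Φ (C (MvPolynomial.X z))).coeff 0 = MvPolynomial.X z) : Φ (C (MvPolynomial.X z)) = C (MvPolynomial.X z) := by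
  refine Polynomial.ext fun s => ?_
  rw [Polynomial.coeff_C]
  rcases Nat.eq_zero_or_pos s with rfl | hs
  · rw [if_pos rfl, h0]
  rw [if_neg hs.ne']
  refine MvPolynomial.ext _ _ fun κ => ?_
  rw [MvPolynomial.coeff_zero]
  by_cases hκ0 : κ = 0
  · subst hκ0; exact hpure s
  by_contra hne
  obtain ⟨x, hx⟩ := Finsupp.support_nonempty_iff.mpr hκ0
  have hwt : Finsupp.weight w κ = w z - s • ρ := (hΦ.isTW_CX z) s hne
  have hle : w x ≤ Finsupp.weight w κ := le_weight_of_mem_support' hw κ hx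
  have hsρ : ρ ≤ s • ρ := by
    rw [nsmul_eq_mul]
    have h1 : (1 : ℚ) ≤ s := by exact_mod_cast hs
    nlinarith
  have hzx : w z ≤ w x := by
    by_cases hHx : H x
    · exact (hsep z x hz hHx).le
    · exact (hclass z x hz hHx).le
  linarith

/-- **THEOREM KL-F, the trichotomy (α) / (β) / (γ)** (ours; T84): see the module docstring.  `H` = kept slots, the killed slots are
the bottom class. [cite: AbramovichTemkinWlodarczyk2024, Thm. 5.3.1 (2)–(3) (p. 1578)] -/
theorem trichotomy (hw : ∀ j, 0 ≤ w j) (hρ : 0 < ρ) (hsep : ∀ z x, ¬ H z → H x → w z < w x)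
    (hclass : ∀ z z', ¬ H z → ¬ H z' → w z = w z') {G : MvPolynomial ι k}
    {Φ : (MvPolynomial ι k)[X] →+* (MvPolynomial ι k)[X]} (hΦ : IsGradedIso w ρ G Φ)
    (h0 : ∀ z, ¬ H z → (Φ (C (MvPolynomial.X z))).coeff 0 = MvPolynomial.X z) :
    (∃ z, ¬ H z ∧ ∃ s, pureCoeff Φ z s ≠ 0) ∨
    ((∀ z, ¬ H z → Φ (C (MvPolynomial.X z)) = C (MvPolynomial.X z)) ∧
      (∀ x, killHom H (Φ (C (MvPolynomial.X x)) - C (MvPolynomial.X x)) = 0) ∧ reduce H Φ = killHom H) ∨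
    (reduce H Φ ≠ killHom H ∧ IsGradedIso w ρ (killLight H G) (reduce H Φ) ∧
      (∀ z, ¬ H z → reduce H Φ (C (MvPolynomial.X z)) = 0) ∧ ∀ x s, pureCoeff (reduce H Φ) x s = pureCoeff Φ x s) := by
  by_cases hα : ∃ z, ¬ H z ∧ ∃ s, pureCoeff Φ z s ≠ 0
  · exact Or.inl hα
  have hpure : ∀ z, ¬ H z → ∀ s, pureCoeff Φ z s = 0 := fun z hz s => by
    by_contra h
    exact hα ⟨z, hz, s, h⟩
  have hZ : ∀ z, ¬ H z → killHom H (Φ (C (MvPolynomial.X z))) = 0 := fun z hz =>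
    killHom_map_CX_eq_zero H hw hρ.le hsep hΦ.graded hz (hpure z hz)
  have hfix : ∀ z, ¬ H z → Φ (C (MvPolynomial.X z)) = C (MvPolynomial.X z) := fun z hz =>
    map_CX_eq_of_bottom H hw hρ hsep hclass hΦ.graded hz (hpure z hz) (h0 z hz)
  by_cases hβ : reduce H Φ = killHom H
  · refine Or.inr (Or.inl ⟨hfix, fun x => ?_, hβ⟩)
    by_cases hx : H x
    · exact ((reduce_eq_killHom_iff_sub H hΦ.graded.map_C_C hΦ.map_X hZ).mp hβ) x hx
    · rw [hfix x hx, sub_self, map_zero]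
  · exact Or.inr (Or.inr ⟨hβ, isGradedIso_reduce H hw hρ.le hsep hΦ hpure, fun z hz => reduce_C_X_of_not H hZ hz,
      fun x s => pureCoeff_reduce H Φ x s⟩)

/-- The (β)-branch restated (ours): "`Φ̄ = id`" iff every shift dies under the kill, given that the bottom slots are fixed.
[cite: AbramovichTemkinWlodarczyk2024, Thm. 5.3.1 (2)–(3) (p. 1578)] -/
theorem reduce_eq_killHom_iff_forall_sub {Φ : (MvPolynomial ι k)[X] →+* (MvPolynomial ι k)[X]}
    (hC : ∀ c : k, Φ (C (MvPolynomial.C c)) = C (MvPolynomial.C c)) (hX : Φ X = X)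
    (hfix : ∀ z, ¬ H z → Φ (C (MvPolynomial.X z)) = C (MvPolynomial.X z)) :
    reduce H Φ = killHom H ↔ ∀ x, killHom H (Φ (C (MvPolynomial.X x)) - C (MvPolynomial.X x)) = 0 := by
  have hZ : ∀ z, ¬ H z → killHom H (Φ (C (MvPolynomial.X z))) = 0 := fun z hz => by
    rw [hfix z hz, killHom_C_X_of_not H hz]
  rw [reduce_eq_killHom_iff_sub H hC hX hZ]
  refine ⟨fun h x => ?_, fun h x _ => h x⟩
  by_cases hx : H x
  · exact h x hx
  · rw [hfix x hx, sub_self, map_zero]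

end KillSegment

end Literature.AlgebraicGeometry.Resolution.WeightedBlowup
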